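import Mathlib

/-!
# IotaNu — typed form of question Q6 / Conjecture (Iν) of SEEDSPEC-krylov-seed.md §7 (val-idea-26 g0, lens a) — rev 2

`ι(m, ν)` := the largest dimension of an IRREDUCIBLE linear space of nilpotent `m × m` complex matrices containing
an element of nilpotency index `≥ ν`.  Conjecture (Iν) («`ι(m, ν) ≤ C·(m/ν)² + c·m`») was typed here at 17:08Z.

**STATUS (rev 2, 17:2xZ): the sharp form is REFUTED numerically and the conjecture is WITHDRAWN.**  val-idea-29's
card `dense-irreducible` exhibits irreducible nilpotent spaces of FULL index `ν = b` and dimension ≈ b²/4: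
`(b, dim) = (5,5), (6,8), (7,12), (9,19)` (generators listed there); replicated by this seat exactly mod p
(`check_W29.py`: all members nilpotent, generic index b, Burnside algebra = M_b).  At `ν = m = b` the sharp form says
`dim ≤ b + 1`, violated by `(6,8), (7,12), (9,19)`; the existential form survives finite data only formally and is no
longer proposed.  What remains useful is the typed NEGATIVE target: `not_iotaNuConjectureSharp_of_witness` below reduces
`¬ IotaNuConjectureSharp` to a kernel certificate for ONE space (e.g. `W₆ = MOR₂ + E₄₃ + E₄₅ + E₂₅ ⊂ M₆`: nilpotent,
irreducible, index 6, dimension 8 — an `irrFour_irreducible`-style computation, Negative-lane sized).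
Nothing here bears on `HeavyTopLaw`/24318; VP ≠ VNP is NOT proved.
-/

set_option linter.dupNamespace false

namespace Summit.ValiantsHypothesis.ValiantsHypothesis.Cruxes.DualUnipotentThreeHalves.KrylovSeed

open Matrix

variable {m : ℕ}

/-- `W ⊆ M_m(ℂ)` is a space of nilpotent matrices. -/
def IsNilpotentSpace (W : Submodule ℂ (Matrix (Fin m) (Fin m) ℂ)) : Prop :=
  ∀ A ∈ W, A ^ m = 0

/-- `W` is IRREDUCIBLE: the only subspaces of `ℂ^m` invariant under every member of `W` are `0` and `ℂ^m`
(the tree's phrasing in `…HeavyTopIrreducibleData.irrThree_irreducible`). -/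
def IsIrreducibleSpace (W : Submodule ℂ (Matrix (Fin m) (Fin m) ℂ)) : Prop :=
  ∀ U : Submodule ℂ (Fin m → ℂ), (∀ A ∈ W, ∀ u ∈ U, A *ᵥ u ∈ U) → U = ⊥ ∨ U = ⊤

/-- `W` has (generic) nilpotency index at least `ν`: some member has `A^{ν-1} ≠ 0`. -/
def HasIndexGe (W : Submodule ℂ (Matrix (Fin m) (Fin m) ℂ)) (ν : ℕ) : Prop :=
  ∃ A ∈ W, A ^ (ν - 1) ≠ 0

/-- **Conjecture (Iν)** (SEEDSPEC §7, proposed PREREG Q6), division-free form of `ι(m,ν) ≤ C (m/ν)² + c m`: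
`ν² · dim W ≤ C m² + c ν² m` for every irreducible nilpotent `W ⊆ M_m(ℂ)` of index `≥ ν`.  OPEN; never asserted. -/
def IotaNuConjecture : Prop :=
  ∃ C c : ℕ, ∀ (m ν : ℕ), 1 ≤ ν → ∀ W : Submodule ℂ (Matrix (Fin m) (Fin m) ℂ),
    IsNilpotentSpace W → IsIrreducibleSpace W → HasIndexGe W ν →
      ν ^ 2 * Module.finrank ℂ W ≤ C * m ^ 2 + c * ν ^ 2 * m

/-- The sharp form (`C = c = 1`) suggested by the calibration families 𝓜_k, Irr_q, 𝓘_{q,k} — **REFUTED numerically**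
(rev 2) by val-idea-29's full-index irreducible spaces `(b, dim) = (6,8), (7,12), (9,19)`: at `ν = m = b` it demands
`dim ≤ b + 1`.  Kept as the statement whose NEGATION is the typed target below.  Never asserted. -/
def IotaNuConjectureSharp : Prop :=
  ∀ (m ν : ℕ), 1 ≤ ν → ∀ W : Submodule ℂ (Matrix (Fin m) (Fin m) ℂ),
    IsNilpotentSpace W → IsIrreducibleSpace W → HasIndexGe W ν →
      ν ^ 2 * Module.finrank ℂ W ≤ m ^ 2 + ν ^ 2 * m

/-- Sanity (PROVED): the sharp form implies the existential form. -/
theorem iotaNuConjecture_of_sharp (h : IotaNuConjectureSharp) : IotaNuConjecture :=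
  ⟨1, 1, fun m ν hν W h1 h2 h3 => by simpa using h m ν hν W h1 h2 h3⟩

/-- **Negative target, reduction (PROVED).**  One irreducible nilpotent space `W ⊆ M_m(ℂ)` of index `≥ ν` with
`m² + ν²·m < ν²·dim W` refutes the sharp form; e.g. `m = ν = 6`, `dim W = 8` (`36 + 216 = 252 < 288`) — idea-29's `W₆`,
once its nilpotency / irreducibility / index are kernel-certified. -/
theorem not_iotaNuConjectureSharp_of_witness {m ν : ℕ} (hν : 1 ≤ ν) (W : Submodule ℂ (Matrix (Fin m) (Fin m) ℂ))
    (h1 : IsNilpotentSpace W) (h2 : IsIrreducibleSpace W) (h3 : HasIndexGe W ν)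
    (hlt : m ^ 2 + ν ^ 2 * m < ν ^ 2 * Module.finrank ℂ W) : ¬ IotaNuConjectureSharp :=
  fun h => absurd (h m ν hν W h1 h2 h3) (not_le.mpr hlt)

/-- The arithmetic of the `W₆` witness: `6² + 6²·6 < 6²·8`. -/
example : 6 ^ 2 + 6 ^ 2 * 6 < 6 ^ 2 * 8 := by norm_num

end Summit.ValiantsHypothesis.ValiantsHypothesis.Cruxes.DualUnipotentThreeHalves.KrylovSeed
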